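import Summits.AtomisticToContinuum.Crystallization.Theorems.HullExactificationCascadeHcpLandscapeGapStubBoxMinimiserRigid
import Summits.AtomisticToContinuum.Crystallization.Theorems.HullExactificationCascadeHcpLandscapeGapStubBoundaryLayer
import Summits.AtomisticToContinuum.Crystallization.Theorems.HullExactificationCascadeHcpLandscapeGapStubGoodOfNoBadBond
import Summits.AtomisticToContinuum.Crystallization.Theorems.HullExactificationCascadeHcpLandscapeGapStubChargeToBadBond
import Summits.AtomisticToContinuum.Crystallization.Theorems.HullExactificationCascadeHcpLandscapeGapStubExactWindowEnergy
import Summits.AtomisticToContinuum.Crystallization.Theorems.ReggeStarCoercivityDefectFreeCrystallizesSiteColumnLJ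
import Summits.AtomisticToContinuum.Crystallization.Theorems.PricedLinkCensusStackingHingeHcpBoxModulus
import Summits.AtomisticToContinuum.Crystallization.Theorems.PricedLinkCensusStackingHingeJ2Neg
import Summits.AtomisticToContinuum.Crystallization.Theorems.PricedLinkCensusStackingHingeLjDomination

/-!
# Route HullExactificationCascade — crux B `HcpLandscapeGap` (stmt-AtomisticToContinuum-12087), line `birth`:
# the EXACT-BARLOW pricing (T_exact), assembled from the landed stubs E1, G1, G2 (lead c5)

The registered stub `stub_exactBarlowPricing` (T_exact) of skeleton v7 (`Cruxes/HcpLandscapeGap/Lines/birth.lean`),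
assembled over the LANDED wave-1 stubs E1 (`stub_exactWindowEnergy`, p158213), G1 (`stub_goodOfNoBadBond`, p157977) and
G2 (`stub_chargeToBadBond`, p157978), where
T_exact is B's priced inequality `n·e_LJ(hcp a h) + κ·#{i : ¬Good_x(4,θ,i)} ≤ 𝓔_LJ(x) + C(L+1)²` at the
minimiser `(a,h)` of `e_LJ(hcp · ·)` over B's box, for every injective enumeration `x` of a window `S ∩ B̄_L(c)` of
an EXACT rigid image `S = v + B '' barlowStacking a' h' s` of a uniform Barlow stacking (`s` a periodic Hägg
word, `(a', h')` in the box `47/50 ≤ a' ≤ 1`, `39/50·a' ≤ h' ≤ 17/20·a'` of route HcpDefectCounting).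

Proof.  (0) B's box minimiser `(a,h)` is global (`stub_boxMinimiserRigid`) and enclosed in the box, so the
modulus of `stub_hcpBoxModulus` is centred at it (`modulus_at_boxMinimiser`).  (1) ENERGY: `𝓔(x) ≥ Σ_t barlowSiteEnergy(a',h',s,m t)` (E1) and the certified
Lennard-Jones site-energy column (`PalmGoodLaw.SiteColumnLJ.stub_siteColumnLJ`, with the uniform gap
`½(J₃ − J₂) ≥ (3/8)·c₀` from `stub_J2neg` + `stub_ljDomination`) give
`𝓔(x) ≥ n·e(hcp a' h') + g·#{t : s (m t + 1) = s (m t)}`.  (2) FAR SCALES (`|a'−a| > δ₁` or `|h'−h| > δ₁`):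
every site pays `c·δ₁²` through the modulus.  (3) NEAR SCALES: a site that is neither within `K` layers of a bad
bond nor within depth `5` of the window boundary is `Good(4, θ)` (G1 at tolerance `min θ ½`: the matched
stacking points lie within `4½` of the site, hence inside the ball); sites near a bad bond are charged `M`-to-one
to bad-bond layers or to the boundary layer of depth `ρ` (G2); boundary layers hold `≤ C_b (L+1)²` sites
(`stub_boundaryLayer`, separation `7/10`); `κ = min (g/(M+1)) (c δ₁²)`, `C = 2 κ C_b`.  All `[folklore]`.
-/

noncomputable section

namespace Summit.AtomisticToContinuum.Crystallization.Theorems.HcpLandscapeGapBirth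

open Literature.MathematicalPhysics.StatisticalMechanics

/-! ## The uniform coupling gap and the site-energy column with `e_LJ(hcp)` -/

/-- **Uniform gap of the Lennard-Jones registry couplings on the box**: there is `g > 0` with
`g ≤ ½ (J₃ − J₂)(a, h)` for all `(a, h)` in the box `47/50 ≤ a ≤ 1`, `39/50·a ≤ h ≤ 17/20·a`.  Indeed
`J₂ ≤ −c₀` uniformly (`stub_J2neg`) and the `k = 3` term of the half-domination
`Σ_{k≥3} (k−1)|J_k| ≤ ½|J₂|` (`stub_ljDomination`, summable by `stub_ljRegistryDomination`) gives
`2|J₃| ≤ ½|J₂|`, so `J₃ − J₂ ≥ ¾|J₂| ≥ ¾ c₀`. [folklore] -/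
theorem uniform_coupling_gap : ∃ g : ℝ, 0 < g ∧ ∀ a h : ℝ, 47 / 50 ≤ a → a ≤ 1 → 39 / 50 * a ≤ h →
    h ≤ 17 / 20 * a →
      g ≤ (1 / 2) * (barlowCoupling lennardJones a h 3 - barlowCoupling lennardJones a h 2) := by
  obtain ⟨c₀, hc₀, hJ⟩ := PricedHcpWindowsJ2Neg.stub_J2neg
  refine ⟨3 / 8 * c₀, by positivity, fun a h ha ha1 hh hh1 => ?_⟩
  obtain ⟨hS, hJ2, hT⟩ := PricedHcpWindowsLjRegistry.stub_ljRegistryDomination a h ha ha1 hh hh1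
  have hJ2c := hJ a h ha ha1 hh hh1
  set J := barlowCoupling lennardJones a h with hJdef
  have hnn : ∀ k : ℕ, 0 ≤ (if 3 ≤ k then ((k : ℝ) - 1) * |J k| else 0) := by
    intro k
    split_ifs with hk
    · have hk' : (3 : ℝ) ≤ k := by exact_mod_cast hk
      exact mul_nonneg (by linarith) (abs_nonneg _)
    · exact le_rfl
  have hf : Summable fun k : ℕ => (if 3 ≤ k then ((k : ℝ) - 1) * |J k| else 0) := by
    refine Summable.of_nonneg_of_le hnn (fun k => ?_) hS
    split_ifs with hk
    · exact mul_le_mul_of_nonneg_right (by linarith) (abs_nonneg _)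
    · exact mul_nonneg (Nat.cast_nonneg _) (abs_nonneg _)
  have h3 := hf.le_tsum 3 (fun k _ => hnn k)
  have h3' : (if 3 ≤ (3 : ℕ) then (((3 : ℕ) : ℝ) - 1) * |J 3| else 0) = 2 * |J 3| := by
    norm_num
  rw [h3'] at h3
  have hJ2abs : |J 2| = -J 2 := abs_of_neg hJ2
  have hge : -|J 3| ≤ J 3 := neg_abs_le _
  linarith

/-- **Site-energy column with the energy per particle and a uniform gap**: there is `g > 0` such that
for all `(a, h)` in the box, every Hägg word `s` and every layer `m`,
`e_LJ(hcp a h) + g·([s (m+1) = s m] + [s (m−1) = s (m−2)]) ≤ barlowSiteEnergy LJ a h s m`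
(`stub_siteColumnLJ` with `hcpE a h = e_LJ(hcp a h)` by `hcpEnergySeries_of_eq`). [folklore] -/
theorem siteColumn_uniform : ∃ g : ℝ, 0 < g ∧ ∀ (a h : ℝ) (ha : a ≠ 0) (hh : h ≠ 0), 47 / 50 ≤ a →
    a ≤ 1 → 39 / 50 * a ≤ h → h ≤ 17 / 20 * a → ∀ s : ℤ → ℤ, IsHaggSeq s → ∀ m : ℤ,
      (hcpPeriodicConfiguration ha hh).energyPerParticle lennardJones +
          g * ((if s (m + 1) = s m then 1 else 0) + (if s (m - 1) = s (m - 2) then 1 else 0)) ≤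
        barlowSiteEnergy lennardJones a h s m := by
  obtain ⟨g, hg, hgap⟩ := uniform_coupling_gap
  refine ⟨g, hg, fun a h ha hh ha1 ha2 hh1 hh2 s hs m => ?_⟩
  have hcol := (PalmGoodLaw.SiteColumnLJ.stub_siteColumnLJ a h ha1 ha2 hh1 hh2).2 s hs m
  have hE : PalmUnimodularRigidity.LayeredLawsSelectHcp.hcpE a h =
      (hcpPeriodicConfiguration ha hh).energyPerParticle lennardJones :=
    ((ExcessDecayLiouvilleCoarseGrains.hcpEnergySeries_of_eq a h ha hh
      PalmUnimodularRigidity.LayeredLawsSelectHcp.hcpQ rfl).2.2).symm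
  have hind : (0 : ℝ) ≤ (if s (m + 1) = s m then 1 else 0) + (if s (m - 1) = s (m - 2) then 1 else 0) := by
    split_ifs <;> norm_num
  have hg' := hgap a h ha1 ha2 hh1 hh2
  rw [hE] at hcol
  have hmul := mul_le_mul_of_nonneg_right hg' hind
  linarith

/-! ## B's box minimiser is the centre of the certified modulus -/

/-- **Modulus at B's box minimiser.**  If `(a, h)` minimises `e_LJ(hcp · ·)` over B's box
`9/10 < a < 1`, `|h − a√(2/3)| ≤ a/100`, then `(a, h)` lies in the box of route HcpDefectCounting and
`e_LJ(hcp a h) + c·((a' − a)² + (h' − h)²) ≤ e_LJ(hcp a' h')` on that box for some `c > 0`: the minimiser is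
global and enclosed (`stub_boxMinimiserRigid`), so the modulus inequality of `stub_hcpBoxModulus` at `(a, h)`
forces it to coincide with the modulus centre `(a₀, h₀)`. [folklore] -/
theorem modulus_at_boxMinimiser : ∀ (a h : ℝ) (ha : a ≠ 0) (hh : h ≠ 0),
    (9 / 10 < a ∧ a < 1 ∧ |h - a * Real.sqrt (2 / 3)| ≤ a / 100) →
    (∀ a' h' : ℝ, ∀ ha' : a' ≠ 0, ∀ hh' : h' ≠ 0,
      (9 / 10 < a' ∧ a' < 1 ∧ |h' - a' * Real.sqrt (2 / 3)| ≤ a' / 100) →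
        (hcpPeriodicConfiguration ha hh).energyPerParticle lennardJones ≤
          (hcpPeriodicConfiguration ha' hh').energyPerParticle lennardJones) →
    (47 / 50 ≤ a ∧ a ≤ 1 ∧ 39 / 50 * a ≤ h ∧ h ≤ 17 / 20 * a) ∧
    ∃ c : ℝ, 0 < c ∧ ∀ (a' h' : ℝ) (ha' : a' ≠ 0) (hh' : h' ≠ 0),
      47 / 50 ≤ a' → a' ≤ 1 → 39 / 50 * a' ≤ h' → h' ≤ 17 / 20 * a' →
        (hcpPeriodicConfiguration ha hh).energyPerParticle lennardJones +
            c * ((a' - a) ^ 2 + (h' - h) ^ 2) ≤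
          (hcpPeriodicConfiguration ha' hh').energyPerParticle lennardJones := by
  intro a h ha hh hbox hmin
  obtain ⟨⟨hea, heh⟩, hglob⟩ := stub_boxMinimiserRigid a h ha hh hbox hmin
  rw [abs_le] at hea heh
  have hab : 47 / 50 ≤ a ∧ a ≤ 1 ∧ 39 / 50 * a ≤ h ∧ h ≤ 17 / 20 * a := by
    refine ⟨by linarith, by linarith, by linarith, by linarith⟩
  refine ⟨hab, ?_⟩
  obtain ⟨a₀, h₀, ha₀, hh₀, c, hc, hb0, hmod⟩ := PricedHcpWindowsHcpBoxModulus.stub_hcpBoxModulus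
  have h1 := hmod a h ha hh hab
  have h2 := hglob a₀ h₀ ha₀ hh₀ (by linarith [hb0.1]) (by linarith [hb0.1, hb0.2.2.1])
  have hD : (a - a₀) ^ 2 + (h - h₀) ^ 2 ≤ 0 := by
    by_contra hD
    push Not at hD
    have := mul_pos hc hD
    linarith
  have hsa : a - a₀ = 0 := by nlinarith [sq_nonneg (a - a₀), sq_nonneg (h - h₀)]
  have hsh : h - h₀ = 0 := by nlinarith [sq_nonneg (a - a₀), sq_nonneg (h - h₀)]
  obtain rfl : a₀ = a := by linarith
  obtain rfl : h₀ = h := by linarith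
  refine ⟨c, hc, fun a' h' ha' hh' h1' h2' h3' h4' => ?_⟩
  have h3 := hmod a' h' ha' hh' ⟨h1', h2', h3', h4'⟩
  have e1 : (a' - a₀) ^ 2 + (h' - h₀) ^ 2 = (a₀ - a') ^ 2 + (h₀ - h') ^ 2 := by ring
  linarith [h3]

/-! ## The assembly -/

/-- Cardinality of a subtype of `Fin n` as the cardinality of the filtered finset (real cast). [folklore] -/
theorem natCard_subtype_eq_card_filter {n : ℕ} (P : Fin n → Prop) [DecidablePred P] :
    (Nat.card {t : Fin n // P t} : ℝ) = ((Finset.univ.filter P).card : ℝ) := by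
  rw [Nat.card_eq_fintype_card, Fintype.card_subtype]

/-- **The exact-Barlow pricing T_exact** (registered stub `stub_exactBarlowPricing` of skeleton v7 of crux
stmt-AtomisticToContinuum-12087): B's priced inequality for every window of every exact rigid image of a uniform
Barlow stacking (periodic Hägg word, scale in the HcpDefectCounting box), at B's box minimiser — assembled from the
landed E1, G1, G2 (see the file header for the proof). [folklore] -/
theorem stub_exactBarlowPricing : (∀ (a h : ℝ) (ha : a ≠ 0) (hh : h ≠ 0), (9 / 10 < a ∧ a < 1 ∧ |h - a * Real.sqrt (2 / 3)| ≤ a / 100) → (∀ a' h' : ℝ, ∀ ha' : a' ≠ 0, ∀ hh' : h' ≠ 0, (9 / 10 < a' ∧ a' < 1 ∧ |h' - a' * Real.sqrt (2 / 3)| ≤ a' / 100) → (Literature.MathematicalPhysics.StatisticalMechanics.hcpPeriodicConfiguration ha hh).energyPerParticle Literature.MathematicalPhysics.StatisticalMechanics.lennardJones ≤ (Literature.MathematicalPhysics.StatisticalMechanics.hcpPeriodicConfiguration ha' hh').energyPerParticle Literature.MathematicalPhysics.StatisticalMechanics.lennardJones) → ∀ θ : ℝ, 0 < θ → ∃ κ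 : ℝ, 0 < κ ∧ ∃ C : ℝ, ∀ (a' h' : ℝ), 47 / 50 ≤ a' → a' ≤ 1 → 39 / 50 * a' ≤ h' → h' ≤ 17 / 20 * a' → ∀ s : ℤ → ℤ, Literature.MathematicalPhysics.StatisticalMechanics.IsHaggSeq s → ∀ p : ℕ, p ≠ 0 → (∀ i : ℤ, s (i + p) = s i) → ∀ (B : EuclideanSpace ℝ (Fin 3) →ₗᵢ[ℝ] EuclideanSpace ℝ (Fin 3)) (v c : EuclideanSpace ℝ (Fin 3)) (L : ℝ), 0 ≤ L → ∀ (n : ℕ) (x : Fin n → EuclideanSpace ℝ (Fin 3)), Function.Injective x → Set.range x = {y : EuclideanSpace ℝ (Fin 3) | y ∈ (fun w => v + B w) '' Literature.MathematicalPhysics.StatisticalMechanics.barlowStacking a' h' s ∧ dist y c ≤ L} → (n : ℝ) * (Literature.MathematicalPhysics.StatisticalMechanics.hcpPeriodicConfiguration ha hh).energyPerParticle Literature.MathematicalPhysics.StatisticalMechanics.lennardJones + κ * (Nat.card {i : Fin n // ¬ (∃ A : EuclideanSpace ℝ (Fin 3) →ₗᵢ[ℝ] EuclideanSpace ℝ (Fin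 3), (∀ p ∈ (Literature.MathematicalPhysics.StatisticalMechanics.hcpPeriodicConfiguration ha hh).points, ‖p‖ ≤ 4 → ∃ j : Fin n, dist (x j) (x i + A p) ≤ θ) ∧ (∀ j : Fin n, dist (x j) (x i) ≤ 4 → ∃ p ∈ (Literature.MathematicalPhysics.StatisticalMechanics.hcpPeriodicConfiguration ha hh).points, dist (x j) (x i + A p) ≤ θ))} : ℝ) ≤ Literature.MathematicalPhysics.StatisticalMechanics.interactionEnergy Literature.MathematicalPhysics.StatisticalMechanics.lennardJones x + C * (L + 1) ^ 2) := by
  intro a h ha hh hbox hmin θ hθ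
  have hE1 := stub_exactWindowEnergy
  have hG1 := stub_goodOfNoBadBond
  have hG2 := stub_chargeToBadBond
  classical
  -- (0) modulus at B's minimiser, positivity of the scale
  obtain ⟨⟨hab1, hab2, hab3, hab4⟩, c, hc, hmod⟩ := modulus_at_boxMinimiser a h ha hh hbox hmin
  have ha0 : 0 < a := by linarith
  have hh0 : 0 < h := by linarith
  -- tolerance `θ' = min θ ½`, geometry constants, gap, boundary constant
  set θ' : ℝ := min θ (1 / 2) with hθ'
  have hθ'0 : 0 < θ' := lt_min hθ (by norm_num)
  have hθ'θ : θ' ≤ θ := min_le_left _ _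
  have hθ'h : θ' ≤ 1 / 2 := min_le_right _ _
  obtain ⟨δ₁, hδ₁, K, hG⟩ := hG1 a h ha0 hh0 θ' hθ'0
  obtain ⟨M, ρ, hρ, hC⟩ := hG2 K
  obtain ⟨g, hg, hcol⟩ := siteColumn_uniform
  obtain ⟨Cb, hCb⟩ := stub_boundaryLayer (7 / 10) (by norm_num) (max ρ 5) (le_max_of_le_right (by norm_num))
  -- the constants
  set κ : ℝ := min (g / (M + 1)) (c * δ₁ ^ 2) with hκ
  have hκ0 : 0 < κ := lt_min (by positivity) (by positivity)
  have hκg : κ ≤ g / (M + 1) := min_le_left _ _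
  have hκc : κ ≤ c * δ₁ ^ 2 := min_le_right _ _
  refine ⟨κ, hκ0, 2 * κ * Cb, ?_⟩
  intro a' h' ha'1 ha'2 hh'1 hh'2 s hs p hp hper B v cc L hL n x hx hrange
  have ha'0 : 0 < a' := by linarith only [ha'1]
  have hh'0 : 0 < h' := by linarith only [hh'1, ha'1]
  have ha' : a' ≠ 0 := ha'0.ne'
  have hh' : h' ≠ 0 := hh'0.ne'
  -- the image set and its separation
  set S : Set (EuclideanSpace ℝ (Fin 3)) := (fun w => v + B w) '' barlowStacking a' h' s with hSdef
  have hsep : ∀ y ∈ S, ∀ z ∈ S, y ≠ z → (7 / 10 : ℝ) ≤ dist y z := by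
    rintro y ⟨w₁, hw₁, rfl⟩ z ⟨w₂, hw₂, rfl⟩ hyz
    have hw : w₁ ≠ w₂ := fun h0 => hyz (by rw [h0])
    have hd : dist (v + B w₁) (v + B w₂) = dist w₁ w₂ := by
      rw [dist_add_left, B.dist_map]
    rw [hd]
    have h1 := le_dist_of_mem_barlowStacking a' h' s ha'0.le hh'0.le hw₁ hw₂ hw
    have h2 : (7 / 10 : ℝ) ≤ min a' h' := le_min (by linarith only [ha'1]) (by linarith only [hh'1, ha'1])
    linarith only [h1, h2]
  -- window membership and the parametrisation of the sites
  have hmem : ∀ t, x t ∈ S ∧ dist (x t) cc ≤ L := fun t => by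
    have : x t ∈ Set.range x := Set.mem_range_self t
    rw [hrange] at this
    exact this
  have hpar : ∀ t, ∃ q : ℤ × ℤ × ℤ, x t = v + B (barlowPos a' h' s q.1 q.2.1 q.2.2) := fun t => by
    obtain ⟨w, ⟨k, i, j, rfl⟩, hw⟩ := (hmem t).1
    exact ⟨(k, i, j), hw.symm⟩
  choose q hq using hpar
  set m : Fin n → ℤ := fun t => (q t).1 with hmdef
  set i : Fin n → ℤ := fun t => (q t).2.1 with hidef
  set j : Fin n → ℤ := fun t => (q t).2.2 with hjdef
  have hxt : ∀ t, x t = v + B (barlowPos a' h' s (m t) (i t) (j t)) := fun t => hq t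
  -- (1) ENERGY: window energy ≥ Σ site energies ≥ n·e(a',h') + g·#Earn
  have hE := hE1 a' h' ha'1 ha'2 hh'1 hh'2 s hs p hp hper B v n x hx m i j hxt
  set Earn : Finset (Fin n) := Finset.univ.filter (fun t => s (m t + 1) = s (m t)) with hEarn
  have hcolsum : (n : ℝ) * (hcpPeriodicConfiguration ha' hh').energyPerParticle lennardJones +
      g * (Earn.card : ℝ) ≤ ∑ t : Fin n, barlowSiteEnergy lennardJones a' h' s (m t) := by
    have h1 : ∀ t ∈ (Finset.univ : Finset (Fin n)),
        (hcpPeriodicConfiguration ha' hh').energyPerParticle lennardJones +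
            g * (if s (m t + 1) = s (m t) then 1 else 0) ≤
          barlowSiteEnergy lennardJones a' h' s (m t) := by
      intro t _
      have h0 := hcol a' h' ha' hh' ha'1 ha'2 hh'1 hh'2 s hs (m t)
      have hnn : (0 : ℝ) ≤ (if s (m t - 1) = s (m t - 2) then 1 else 0) := by split_ifs <;> norm_num
      have hgnn := mul_nonneg hg.le hnn
      rw [mul_add] at h0
      linarith only [h0, hgnn]
    have h2 := Finset.sum_le_sum h1
    rw [Finset.sum_add_distrib, Finset.sum_const, Finset.card_univ, Fintype.card_fin, nsmul_eq_mul,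
      ← Finset.mul_sum, Finset.sum_boole] at h2
    simpa [hEarn] using h2
  have hfloor : (hcpPeriodicConfiguration ha hh).energyPerParticle lennardJones +
      c * ((a' - a) ^ 2 + (h' - h) ^ 2) ≤
        (hcpPeriodicConfiguration ha' hh').energyPerParticle lennardJones :=
    hmod a' h' ha' hh' ha'1 ha'2 hh'1 hh'2
  -- the bad set and the trivial bound #Bad ≤ n
  set Bad : Finset (Fin n) := Finset.univ.filter (fun i₀ : Fin n =>
    ¬ (∃ A : EuclideanSpace ℝ (Fin 3) →ₗᵢ[ℝ] EuclideanSpace ℝ (Fin 3),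
      (∀ p ∈ (hcpPeriodicConfiguration ha hh).points, ‖p‖ ≤ 4 → ∃ j : Fin n, dist (x j) (x i₀ + A p) ≤ θ) ∧
      (∀ j : Fin n, dist (x j) (x i₀) ≤ 4 →
        ∃ p ∈ (hcpPeriodicConfiguration ha hh).points, dist (x j) (x i₀ + A p) ≤ θ))) with hBad
  have hBadcard : (Nat.card {i₀ : Fin n // ¬ (∃ A : EuclideanSpace ℝ (Fin 3) →ₗᵢ[ℝ] EuclideanSpace ℝ (Fin 3),
      (∀ p ∈ (hcpPeriodicConfiguration ha hh).points, ‖p‖ ≤ 4 → ∃ j : Fin n, dist (x j) (x i₀ + A p) ≤ θ) ∧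
      (∀ j : Fin n, dist (x j) (x i₀) ≤ 4 →
        ∃ p ∈ (hcpPeriodicConfiguration ha hh).points, dist (x j) (x i₀ + A p) ≤ θ))} : ℝ) =
      (Bad.card : ℝ) := by
    rw [hBad]
    exact natCard_subtype_eq_card_filter _
  rw [hBadcard]
  have hBadn : (Bad.card : ℝ) ≤ n := by
    have := Finset.card_filter_le (Finset.univ : Finset (Fin n)) (fun i₀ : Fin n =>
      ¬ (∃ A : EuclideanSpace ℝ (Fin 3) →ₗᵢ[ℝ] EuclideanSpace ℝ (Fin 3),
        (∀ p ∈ (hcpPeriodicConfiguration ha hh).points, ‖p‖ ≤ 4 → ∃ j : Fin n, dist (x j) (x i₀ + A p) ≤ θ) ∧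
        (∀ j : Fin n, dist (x j) (x i₀) ≤ 4 →
          ∃ p ∈ (hcpPeriodicConfiguration ha hh).points, dist (x j) (x i₀ + A p) ≤ θ)))
    rw [Finset.card_univ, Fintype.card_fin] at this
    exact_mod_cast this
  -- boundary layers
  obtain ⟨hbnd, -⟩ := hCb S hsep cc L hL
  have hCb0 : 0 ≤ Cb * (L + 1) ^ 2 := le_trans (Nat.cast_nonneg _) hbnd
  have hWfin : ({y : EuclideanSpace ℝ (Fin 3) | y ∈ S ∧ dist y cc ≤ L} : Set (EuclideanSpace ℝ (Fin 3))).Finite :=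
    finite_of_forall_le_dist_of_subset_closedBall (by norm_num : (0 : ℝ) < 7 / 10)
      (fun p hp q hq hpq => hsep p hp.1 q hq.1 hpq) (c := cc) (R := L)
      (fun p hp => Metric.mem_closedBall.2 hp.2)
  have hbndcount : ∀ r : ℝ, r ≤ max ρ 5 →
      ((Finset.univ.filter (fun t : Fin n => L - r < dist (x t) cc)).card : ℝ) ≤ Cb * (L + 1) ^ 2 := by
    intro r hr
    refine le_trans ?_ hbnd
    set T : Set (EuclideanSpace ℝ (Fin 3)) :=
      {y : EuclideanSpace ℝ (Fin 3) | y ∈ S ∧ dist y cc ≤ L ∧ L - max ρ 5 < dist y cc} with hT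
    have hTfin : T.Finite := hWfin.subset fun y hy => ⟨hy.1, hy.2.1⟩
    have hsubT : (↑((Finset.univ.filter (fun t : Fin n => L - r < dist (x t) cc)).image x) :
        Set (EuclideanSpace ℝ (Fin 3))) ⊆ T := by
      intro y hy
      rw [Finset.coe_image] at hy
      obtain ⟨t, ht, rfl⟩ := hy
      have ht' := (Finset.mem_filter.1 (Finset.mem_coe.1 ht)).2
      exact ⟨(hmem t).1, (hmem t).2, by linarith only [ht', hr]⟩
    have h1 := Set.ncard_le_ncard hsubT hTfin
    rw [Set.ncard_coe_finset, Finset.card_image_of_injective _ hx] at h1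
    exact_mod_cast h1
  -- abbreviations for the two energy levels
  set e : ℝ := (hcpPeriodicConfiguration ha hh).energyPerParticle lennardJones with he
  set e' : ℝ := (hcpPeriodicConfiguration ha' hh').energyPerParticle lennardJones with he'
  have hsq0 : 0 ≤ (a' - a) ^ 2 + (h' - h) ^ 2 := by positivity
  have hee' : e ≤ e' := by
    have := mul_nonneg hc.le hsq0
    linarith only [hfloor, this]
  have hEtot : (n : ℝ) * e' + g * (Earn.card : ℝ) ≤ interactionEnergy lennardJones x := hcolsum.trans hE
  have hEarn0 : (0 : ℝ) ≤ g * (Earn.card : ℝ) := by positivity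
  by_cases hclose : |a' - a| ≤ δ₁ ∧ |h' - h| ≤ δ₁
  · -- (3) NEAR SCALES
    set Near : Finset (Fin n) :=
      Finset.univ.filter (fun t : Fin n => ∃ k : ℤ, |k - m t| ≤ K ∧ s (k + 1) = s k) with hNear
    set Bnd5 : Finset (Fin n) := Finset.univ.filter (fun t : Fin n => L - 5 < dist (x t) cc) with hBnd5
    set Bndρ : Finset (Fin n) := Finset.univ.filter (fun t : Fin n => L - ρ < dist (x t) cc) with hBndρ
    -- Bad ⊆ Near ∪ Bnd5 : the other sites are Good(4, θ) by G1
    have hBadsub : Bad ⊆ Near ∪ Bnd5 := by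
      intro t ht
      rw [Finset.mem_union]
      by_contra hnot
      rw [not_or] at hnot
      obtain ⟨hN, hB5⟩ := hnot
      have hN' : ∀ k : ℤ, |k - m t| ≤ K → s (k + 1) ≠ s k := by
        intro k hk hsk
        exact hN (Finset.mem_filter.2 ⟨Finset.mem_univ _, k, hk, hsk⟩)
      have hB5' : dist (x t) cc ≤ L - 5 := by
        by_contra h0
        exact hB5 (Finset.mem_filter.2 ⟨Finset.mem_univ _, lt_of_not_ge h0⟩)
      obtain ⟨A₂, h1, h2⟩ := hG a' h' ha' hh' hclose.1 hclose.2 s hs B v (m t) (i t) (j t) hN'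
      rw [← hxt t] at h1 h2
      have hgood : ∃ A : EuclideanSpace ℝ (Fin 3) →ₗᵢ[ℝ] EuclideanSpace ℝ (Fin 3),
          (∀ p ∈ (hcpPeriodicConfiguration ha hh).points, ‖p‖ ≤ 4 →
            ∃ j : Fin n, dist (x j) (x t + A p) ≤ θ) ∧
          (∀ j : Fin n, dist (x j) (x t) ≤ 4 →
            ∃ p ∈ (hcpPeriodicConfiguration ha hh).points, dist (x j) (x t + A p) ≤ θ) := by
        refine ⟨A₂, ?_, ?_⟩
        · intro p₀ hp₀ hp4
          rw [hcpPeriodicConfiguration_points] at hp₀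
          obtain ⟨z, hzS, hz1, hz2⟩ := h1 p₀ hp₀ hp4
          have hzW : z ∈ Set.range x := by
            rw [hrange]
            refine ⟨hzS, ?_⟩
            calc dist z cc ≤ dist z (x t) + dist (x t) cc := dist_triangle _ _ _
              _ ≤ (4 + θ') + (L - 5) := add_le_add hz1 hB5'
              _ ≤ L := by linarith only [hθ'h]
          obtain ⟨j', rfl⟩ := hzW
          exact ⟨j', hz2.trans hθ'θ⟩
        · intro j' hj'
          obtain ⟨q₀, hq₀, hq₁⟩ := h2 (x j') (hmem j').1 hj'
          refine ⟨q₀, ?_, hq₁.trans hθ'θ⟩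
          rw [hcpPeriodicConfiguration_points]
          exact hq₀
      exact (Finset.mem_filter.1 ht).2 hgood
    -- counting: #Near ≤ M·#Earn + #Bndρ (G2), boundary layers, #Bad ≤ #Near + #Bnd5
    have hNearle : (Near.card : ℝ) ≤ M * (Earn.card : ℝ) + (Bndρ.card : ℝ) := by
      have h0 := hC a' h' ha'1 ha'2 hh'1 hh'2 s B v cc L n x hx hrange m i j hxt
      have h0' : ((Nat.card {t : Fin n // ∃ k : ℤ, |k - m t| ≤ K ∧ s (k + 1) = s k} : ℕ) : ℝ) ≤
          (((M * Nat.card {t : Fin n // s (m t + 1) = s (m t)} +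
            Nat.card {t : Fin n // L - ρ < dist (x t) cc} : ℕ)) : ℝ) := by
        exact_mod_cast h0
      push_cast at h0'
      rw [natCard_subtype_eq_card_filter, natCard_subtype_eq_card_filter,
        natCard_subtype_eq_card_filter] at h0'
      exact h0'
    have hB5c : (Bnd5.card : ℝ) ≤ Cb * (L + 1) ^ 2 := hbndcount 5 (le_max_right _ _)
    have hBρc : (Bndρ.card : ℝ) ≤ Cb * (L + 1) ^ 2 := hbndcount ρ (le_max_left _ _)
    have hBadle : (Bad.card : ℝ) ≤ Near.card + Bnd5.card := by
      exact_mod_cast (Finset.card_le_card hBadsub).trans (Finset.card_union_le _ _)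
    -- arithmetic
    have hM0 : (0 : ℝ) ≤ M := Nat.cast_nonneg _
    have hEc : (0 : ℝ) ≤ Earn.card := Nat.cast_nonneg _
    have hκM : κ * M ≤ g := by
      calc κ * M ≤ g / (M + 1) * M := mul_le_mul_of_nonneg_right hκg hM0
        _ ≤ g / (M + 1) * (M + 1) := mul_le_mul_of_nonneg_left (by linarith only [hM0]) (by positivity)
        _ = g := by field_simp
    have hne : (n : ℝ) * e ≤ n * e' := mul_le_mul_of_nonneg_left hee' (Nat.cast_nonneg n)
    have s1 : κ * (Bad.card : ℝ) ≤ κ * ((Near.card : ℝ) + Bnd5.card) :=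
      mul_le_mul_of_nonneg_left hBadle hκ0.le
    have s2 : κ * ((Near.card : ℝ) + Bnd5.card) ≤ κ * (M * (Earn.card : ℝ) + Bndρ.card + Bnd5.card) :=
      mul_le_mul_of_nonneg_left (by linarith only [hNearle]) hκ0.le
    have s3 : κ * (M * (Earn.card : ℝ) + Bndρ.card + Bnd5.card) =
        (κ * M) * (Earn.card : ℝ) + κ * ((Bndρ.card : ℝ) + Bnd5.card) := by ring
    have s4 : (κ * M) * (Earn.card : ℝ) ≤ g * (Earn.card : ℝ) := mul_le_mul_of_nonneg_right hκM hEc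
    have s5 : κ * ((Bndρ.card : ℝ) + Bnd5.card) ≤ κ * (2 * (Cb * (L + 1) ^ 2)) :=
      mul_le_mul_of_nonneg_left (by linarith only [hB5c, hBρc]) hκ0.le
    have s6 : κ * (2 * (Cb * (L + 1) ^ 2)) = 2 * κ * Cb * (L + 1) ^ 2 := by ring
    linarith only [s1, s2, s3, s4, s5, s6, hne, hEtot]
  · -- (2) FAR SCALES
    have hfar : δ₁ ^ 2 ≤ (a' - a) ^ 2 + (h' - h) ^ 2 := by
      rw [not_and_or] at hclose
      rcases hclose with h1 | h1
      · have h1' : δ₁ < |a' - a| := lt_of_not_ge h1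
        have : δ₁ ^ 2 < (a' - a) ^ 2 := by
          rw [← sq_abs (a' - a)]
          exact pow_lt_pow_left₀ h1' hδ₁.le two_ne_zero
        linarith only [this, sq_nonneg (h' - h)]
      · have h1' : δ₁ < |h' - h| := lt_of_not_ge h1
        have : δ₁ ^ 2 < (h' - h) ^ 2 := by
          rw [← sq_abs (h' - h)]
          exact pow_lt_pow_left₀ h1' hδ₁.le two_ne_zero
        linarith only [this, sq_nonneg (a' - a)]
    have h1 : κ * (Bad.card : ℝ) ≤ c * δ₁ ^ 2 * n := by
      have h11 : κ * (Bad.card : ℝ) ≤ κ * n := mul_le_mul_of_nonneg_left hBadn hκ0.le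
      have h12 : κ * (n : ℝ) ≤ c * δ₁ ^ 2 * n := mul_le_mul_of_nonneg_right hκc (Nat.cast_nonneg n)
      linarith only [h11, h12]
    have h2 : (n : ℝ) * (e + c * δ₁ ^ 2) ≤ n * e' := by
      refine mul_le_mul_of_nonneg_left ?_ (Nat.cast_nonneg n)
      have := mul_le_mul_of_nonneg_left hfar hc.le
      linarith only [hfloor, this]
    have h2' : (n : ℝ) * e + c * δ₁ ^ 2 * n ≤ n * e' := by
      have e1 : (n : ℝ) * (e + c * δ₁ ^ 2) = n * e + c * δ₁ ^ 2 * n := by ring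
      linarith only [h2, e1]
    have h3 : 0 ≤ 2 * κ * Cb * (L + 1) ^ 2 := by
      have e1 : 2 * κ * Cb * (L + 1) ^ 2 = (2 * κ) * (Cb * (L + 1) ^ 2) := by ring
      rw [e1]
      exact mul_nonneg (by positivity) hCb0
    linarith only [hEtot, hEarn0, h1, h2', h3]


/-- **T_exact by its line name** (`exactBarlowPricing`, as in the skeleton). [folklore] -/
theorem exactBarlowPricing : (∀ (a h : ℝ) (ha : a ≠ 0) (hh : h ≠ 0), (9 / 10 < a ∧ a < 1 ∧ |h - a * Real.sqrt (2 / 3)| ≤ a / 100) → (∀ a' h' : ℝ, ∀ ha' : a' ≠ 0, ∀ hh' : h' ≠ 0, (9 / 10 < a' ∧ a' < 1 ∧ |h' - a' * Real.sqrt (2 / 3)| ≤ a' / 100) → (Literature.MathematicalPhysics.StatisticalMechanics.hcpPeriodicConfiguration ha hh).energyPerParticle Literature.MathematicalPhysics.StatisticalMechanics.lennardJones ≤ (Literature.MathematicalPhysics.StatisticalMechanics.hcpPeriodicConfiguration ha' hh').energyPerParticle Literature.MathematicalPhysics.StatisticalMechanics.lennardJones) → ∀ θ : ℝ, 0 < θ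 → ∃ κ : ℝ, 0 < κ ∧ ∃ C : ℝ, ∀ (a' h' : ℝ), 47 / 50 ≤ a' → a' ≤ 1 → 39 / 50 * a' ≤ h' → h' ≤ 17 / 20 * a' → ∀ s : ℤ → ℤ, Literature.MathematicalPhysics.StatisticalMechanics.IsHaggSeq s → ∀ p : ℕ, p ≠ 0 → (∀ i : ℤ, s (i + p) = s i) → ∀ (B : EuclideanSpace ℝ (Fin 3) →ₗᵢ[ℝ] EuclideanSpace ℝ (Fin 3)) (v c : EuclideanSpace ℝ (Fin 3)) (L : ℝ), 0 ≤ L → ∀ (n : ℕ) (x : Fin n → EuclideanSpace ℝ (Fin 3)), Function.Injective x → Set.range x = {y : EuclideanSpace ℝ (Fin 3) | y ∈ (fun w => v + B w) '' Literature.MathematicalPhysics.StatisticalMechanics.barlowStacking a' h' s ∧ dist y c ≤ L} → (n : ℝ) * (Literature.MathematicalPhysics.StatisticalMechanics.hcpPeriodicConfiguration ha hh).energyPerParticle Literature.MathematicalPhysics.StatisticalMechanics.lennardJones + κ * (Nat.card {i : Fin n // ¬ (∃ A : EuclideanSpace ℝ (Fin 3) →ₗᵢ[ℝ] EuclideanSpace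 ℝ (Fin 3), (∀ p ∈ (Literature.MathematicalPhysics.StatisticalMechanics.hcpPeriodicConfiguration ha hh).points, ‖p‖ ≤ 4 → ∃ j : Fin n, dist (x j) (x i + A p) ≤ θ) ∧ (∀ j : Fin n, dist (x j) (x i) ≤ 4 → ∃ p ∈ (Literature.MathematicalPhysics.StatisticalMechanics.hcpPeriodicConfiguration ha hh).points, dist (x j) (x i + A p) ≤ θ))} : ℝ) ≤ Literature.MathematicalPhysics.StatisticalMechanics.interactionEnergy Literature.MathematicalPhysics.StatisticalMechanics.lennardJones x + C * (L + 1) ^ 2) :=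
  stub_exactBarlowPricing

end Summit.AtomisticToContinuum.Crystallization.Theorems.HcpLandscapeGapBirth

end
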